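import Literature.MathematicalPhysics.QuantumFieldTheory.Balaban1983to89.B13Lemma2Torus

/-!
# `Balaban1983to89.B13Lemma2TorusT7` — T. Bałaban, *Renormalization group approach to lattice gauge field theories.
II. Cluster expansions*, Commun. Math. Phys. **116** (1988) 1–22, doi:10.1007/bf01239022 [Balaban1988RG2Cluster]:
(1.37)–(1.43) pp. 10–11 FOR THE MOST IMPORTANT TERM `(1/g_k²)V(H₁B′)` ON THE TWO-SCALE TORUS — the per-term input of
`B13Lemma2Torus.bound143_twoTorus` (analyticity + a cubic bound with the (1.39)-rate `e^{−(κ₁−1)M⁻⁴|Y∖□|}`) DERIVED from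
the polydisc data of p. 10, and (1.43) `B13.Bound143 W.toStepData c` for that family straight from those inputs

statement-level skeleton of published theorems with citation tags; proofs where landed; nothing here is a claim about
the Yang–Mills mass gap

PDF held: `paper:balaban1988-cmp116-rg-ii-cluster` (journal page = PDF page + 0); p. 10 re-read this session from the
render `run/shared/lean/pub/pub-balaban/b2b-balaban-ref1/pages/1988-cmp116-rg-II-cluster/1988-cmp116-rg-II-cluster-p010-x2.png`
and p. 6 ((1.19)–(1.20)) from `…-p006-x2.png`.

CITATION HEADER (verbatim).  p. 10 [PDF 10]: *"The term corresponding to a domain Y is represented as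
Π_{Δ⊂Y∖□} ∫ds(Δ)(1/2πi)∫dσ(Δ)/(σ(Δ) − s(Δ))² V_□(σ(Y), H₁(σ(Y))B′). (1.38) The above expression is localized in the
interior of Y, with respect to U, J, B′ or B. It is an analytic function of (U, J) in the space U^c_{k+1}(T_η, α′₀, α′₁),
and of B′ in the domain {B′ : e^{16κ₁}|B′| ≦ a₁ on Y}, as it follows from the considerations of the beginning of the
section. The underintegral expression is analytic in σ(Y) on the polydisc |σ(Y)| ≦ e^{κ₁}. The estimates (33), (37), (55),
(57), (58) [15] imply the bound |(1.38)| ≦ C₃(e^{16κ₁}|B′|)³M⁴exp(−(κ₁ − 1)M⁻⁴|Y∖□|), (1.39) where C₃ is an absolute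
constant."*; p. 6 [PDF 6]: *"The function is given by the formula B′ = g_kCB − hD̃(g_kCB). (1.19) It satisfies the bound
|B′| ≦ O(1)g_k|B| + 4C₂(O(1)g_k|B|)² ≦ C₁g_k|B| < C₁ε₁, (1.20) where C₁ is an absolute constant, and g_k|B| < ε₁."*;
p. 10 l. −1 – p. 11 l. 1: *"if e^{16κ₁}|B′| ≦ ⅓a₁. Taking B′ as in (1.19) we obtain the above bound with |B′| replaced by
C₁ε₁."*

WHAT IS REPRODUCED (cell `pub-ymgap`, HUMAN RULING D-0062 Track A, DAG node N10 = [B13], seat `pub-ymgap-dag-n10-b`;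
a NEW LEAF over `B13Lemma2Torus` (same seat), nothing there modified).  Mechanism already in the tree:
`B13CauchyDecay.ineq139_of_polydisc_bound` ((1.38)'s polydisc data ⇒ (1.39)), `B13CauchyDecay.analyticOnNhd_TopC_param`
((1.38) analytic in `B′`), `B13PkScaling.cubic_comp_of_linear_bound` / `mapsTo_ball_of_linear_bound` (composition with the
field map (1.19) under (1.20)) — used BY NAME (the combination is r10's `B13CauchyDecay.norm_Qop_T7_of_polydisc`, whose
conclusion is an operator norm; here the intermediate per-term data are exposed).  THIS FILE:
* §1 **`cubicData_T7_of_polydisc`** (abstract): the underintegral expression `Ψ B′ : (ι → ℂ) → ℂ` separately holomorphic on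
  an open `U ⊇ {|σ| ≤ e^{κ₁}}` (`κ₁ ≥ 1`) for `‖B′‖ < a₁e^{−16κ₁}`, analytic in `B′` for each parameter point, with the sup
  bound `C₃(e^{16κ₁}‖B′‖)³M⁴` on the closed polydisc; the field map `Ψ₁` analytic on `‖w‖ < R₀` with `‖Ψ₁ w‖ ≤ C₁‖w‖`,
  `C₁R₀ ≤ a₁e^{−16κ₁}` ⇒ `W := (B′ ↦ TopC r l (Ψ B′) p) ∘ Ψ₁` is analytic on `‖w‖ < R₀` with
  `‖W w‖ ≤ C₃e^{48κ₁}M⁴e^{−(κ₁−1)|l|}C₁³‖w‖³` — exactly the per-term hypothesis pair `hW`/`hK` of `bound143_twoTorus`;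
* §2 **`bound143_twoTorus_T7`**: on `W : TwoTorusStep 4 L N′`, the family of the most important terms — one per admissible
  cube `□ ∈ Y.1`, the (1.38)-parameters being the OTHER cubes of Y (`(Y.1.erase □).toList`, `#Y.1 − 1` of them, base point
  `s = 0`) — gives `B13.Bound143 W.toStepData c` from the located inputs alone: the polydisc data per (Y, □), the field map
  with (1.20), the identification `hQ`, the space (1.34) in coordinates, `volk = #Y`, `κ₁ ≥ 11/3`, and the floor
  `27·C₃′·C₁³·e^{49κ₁−1} ≤ C₃e^{C₂κ₁}` (C₃′ = the absolute constant of (1.39), C₃ = that of (1.43): *"possibly with other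
  absolute constants"*; the e^{49κ₁−1} inside *"exp C₂κ₁"*, cf. `B13Bound143.floor_of_log`).
HONEST SCOPE.  The polydisc data and the field map are HYPOTHESES by reference ([15] (33), (37), (55), (57), (58); [I]
(I.3.2)/(1.19)); only the T7-type family is instantiated (the other census terms of P^{(k)} enter `bound143_twoTorus` through
its general per-term slots); the parameter index is the torus' cube type `TPt 4 (L·N′)`; `g` complex non-zero, open balls, as
in `B13PkScaling`.  NOT a discharge of node N10 (B13 group FREE at NODE 00 Stages 1–3).  One finite T⁴ programme at fixed
ε; Bałaban AS PRINTED; nothing continuum ∕ OS ∕ mass-gap ∕ Clay.  No `sorry`, no definition, no new named fact (D-0026).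
-/

set_option maxSynthPendingDepth 3

noncomputable section

namespace Literature.MathematicalPhysics.QuantumFieldTheory.Balaban1983to89.B13Lemma2TorusT7

open Metric Set
open Literature.MathematicalPhysics.QuantumFieldTheory.Balaban1983to89
open Literature.MathematicalPhysics.QuantumFieldTheory.Balaban1983to89.TreeLengthTorus
open Literature.MathematicalPhysics.QuantumFieldTheory.Balaban1983to89.B13Lemma3Torus (TwoTorusStep)
open Literature.MathematicalPhysics.QuantumFieldTheory.Balaban1983to89.B13PkScaling
  (Qop scaled mapsTo_ball_of_linear_bound cubic_comp_of_linear_bound)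
open Literature.MathematicalPhysics.QuantumFieldTheory.Balaban1983to89.B13Ineq140 (rad rad_pos Ineq139 cubic_of_139)
open Literature.MathematicalPhysics.QuantumFieldTheory.Balaban1983to89.B13Term214 (TopC SepHolOn)
open Literature.MathematicalPhysics.QuantumFieldTheory.Balaban1983to89.B13CauchyDecay
  (ineq139_of_polydisc_bound analyticOnNhd_TopC_param closedBall_subset_closedBall_of_mem_uIcc)
open Literature.MathematicalPhysics.QuantumFieldTheory.Balaban1983to89.B13Lemma2Torus (bound143_twoTorus)

/-! ## §1. The most important term from the polydisc data of p. 10: analyticity and the cubic bound in `B` -/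

section Abstract

variable {E F : Type*} [NormedAddCommGroup E] [NormedSpace ℂ E] [NormedAddCommGroup F] [NormedSpace ℂ F]
variable {ι : Type*} [DecidableEq ι]

/-- **The T7 term as a scaled cubic term, from the polydisc data** (p. 10 (1.38)–(1.39), p. 6 (1.19)–(1.20)).  For the
underintegral expression `Ψ B′` of (1.38) — separately holomorphic in the parameters on an open `U ⊇ {|σ| ≤ e^{κ₁}}`
(`κ₁ ≥ 1`) for every `B′` of the ball `‖B′‖ < a₁e^{−16κ₁}`, analytic in `B′` there for every parameter point of `U`, and
bounded by `C₃(e^{16κ₁}‖B′‖)³M⁴` on the closed polydisc (*"(33), (37), (55), (57), (58) [15]"*, by reference) — and the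
field map `Ψ₁ : B ↦ B′` at `g_k = 1` ((1.19)), analytic on `‖w‖ < R₀` with the linear-order bound (1.20)
`‖Ψ₁ w‖ ≤ C₁‖w‖` and `C₁R₀ ≤ a₁e^{−16κ₁}`: the composite `W := (B′ ↦ TopC r l (Ψ B′) p) ∘ Ψ₁` (`l` distinct parameters,
base point `‖p_j‖ ≤ 1`, contour radius `0 < r ≤ e^{κ₁} − 1`) is ANALYTIC on `‖w‖ < R₀` and obeys the CUBIC bound
`‖W w‖ ≤ (C₃e^{48κ₁}·M⁴e^{−(κ₁−1)|l|}·C₁³)·‖w‖³` there — (1.39)'s polydisc factor being the iterated Cauchy decay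
(`B13CauchyDecay.ineq139_of_polydisc_bound`). [cite: Balaban1988RG2Cluster, (1.38)–(1.39) p.10] -/
theorem cubicData_T7_of_polydisc {κ₁ a₁ C₃ M C₁ R₀ : ℝ} (ha₁ : 0 < a₁) (hC₃ : 0 ≤ C₃) (hC₁ : 0 ≤ C₁)
    (hκ₁ : 1 ≤ κ₁) {U : Set ℂ} (hU : IsOpen U) (hUexp : closedBall (0 : ℂ) (Real.exp κ₁) ⊆ U)
    {r : ℝ} (hr : 0 < r) (hr' : r ≤ Real.exp κ₁ - 1) {Ψ : F → (ι → ℂ) → ℂ}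
    (hΨ : ∀ q : ι → ℂ, (∀ j, q j ∈ U) → AnalyticOnNhd ℂ (fun B' => Ψ B' q) (ball 0 (rad κ₁ a₁)))
    (hhol : ∀ B' ∈ ball (0 : F) (rad κ₁ a₁), SepHolOn U (Ψ B'))
    (hbd : ∀ B' ∈ ball (0 : F) (rad κ₁ a₁), ∀ q : ι → ℂ, (∀ j, ‖q j‖ ≤ Real.exp κ₁) →
        ‖Ψ B' q‖ ≤ C₃ * (Real.exp (16 * κ₁) * ‖B'‖) ^ 3 * M ^ 4)
    {l : List ι} (hl : l.Nodup) {p : ι → ℂ} (hp : ∀ j, ‖p j‖ ≤ 1)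
    {Ψ₁ : E → F} (hΨa : AnalyticOnNhd ℂ Ψ₁ (ball 0 R₀))
    (h120 : ∀ w ∈ ball (0 : E) R₀, ‖Ψ₁ w‖ ≤ C₁ * ‖w‖) (hrad : C₁ * R₀ ≤ rad κ₁ a₁) :
    AnalyticOnNhd ℂ ((fun B' => TopC r l (Ψ B') p) ∘ Ψ₁) (ball 0 R₀) ∧
      ∀ w ∈ ball (0 : E) R₀, ‖((fun B' => TopC r l (Ψ B') p) ∘ Ψ₁) w‖ ≤
        C₃ * Real.exp (48 * κ₁) * (M ^ 4 * Real.exp (-(κ₁ - 1) * l.length)) * C₁ ^ 3 * ‖w‖ ^ 3 := by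
  have hexp1 : (1 : ℝ) < Real.exp κ₁ := by
    have := Real.add_one_le_exp κ₁; linarith
  have hsub : ∀ s ∈ Set.uIcc (0 : ℝ) 1, closedBall (s : ℂ) r ⊆ U :=
    fun s hs => (closedBall_subset_closedBall_of_mem_uIcc hr' hs).trans hUexp
  have hpU : ∀ j, p j ∈ U := fun j => hUexp (mem_closedBall_zero_iff.2 ((hp j).trans hexp1.le))
  have hFa : AnalyticOnNhd ℂ (fun B' => TopC r l (Ψ B') p) (ball 0 (rad κ₁ a₁)) :=
    analyticOnNhd_TopC_param isOpen_ball hU hr hsub hΨ hhol hl hpU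
  have h139 : Ineq139 (fun B' => TopC r l (Ψ B') p) κ₁ a₁ C₃ M l.length :=
    ineq139_of_polydisc_bound hU hκ₁ hUexp hr hr' hhol hbd hl hp
  have hK0 : 0 ≤ C₃ * Real.exp (48 * κ₁) * (M ^ 4 * Real.exp (-(κ₁ - 1) * l.length)) := by positivity
  have hmaps : MapsTo Ψ₁ (ball (0 : E) R₀) (ball 0 (rad κ₁ a₁)) :=
    mapsTo_ball_of_linear_bound hC₁ (rad_pos ha₁) hrad h120
  exact ⟨hFa.comp hΨa hmaps, cubic_comp_of_linear_bound hK0 (cubic_of_139 h139) h120 hmaps⟩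

end Abstract

/-! ## §2. (1.43) on the two-scale torus for the family of the most important terms -/

section Torus

variable {L N' : ℕ} [NeZero L] [NeZero N']

omit [NeZero L] [NeZero N'] in
/-- The number of (1.38)-parameters `σ(Δ)`, `Δ ⊂ Y∖□`, of the term of the cube `□ ∈ Y` ON THE TORUS: the other cubes of Y,
`#(Y.1.erase □) = #Y.1 − 1` = M⁻⁴|Y∖□| — so the (1.39)-rate `e^{−(κ₁−1)M⁻⁴|Y∖□|}` is `e^{−(κ₁−1)(#Y.1−1)}`.
[cite: Balaban1988RG2Cluster, (1.38)–(1.39) p.10] -/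
theorem length_params_eq {Y : Finset (TPt 4 (L * N'))} {q : TPt 4 (L * N')} (hq : q ∈ Y) :
    (((Y.erase q).toList.length : ℕ) : ℝ) = (Y.card : ℝ) - 1 := by
  rw [Finset.length_toList, Finset.card_erase_of_mem hq,
    Nat.cast_sub (Finset.card_pos.mpr ⟨q, hq⟩), Nat.cast_one]

/-- **(1.43) ON THE TWO-SCALE TORUS FOR THE MOST IMPORTANT TERMS, FROM THE POLYDISC DATA OF p. 10.**  Carrier
`W : TwoTorusStep 4 L N′`, constants `c` (`κ₁ = c.κ₁`, `M = c.M`, `ε₁ = c.ε₁`, `C₁ = c.C₁`).  Per localization domain `Y`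
and admissible cube `□ ∈ Y.1`, at every configuration `φ` of the space (1.34) (its (𝐔, 𝐉)): the underintegral
expression `Ψ Y □ φ B′ σ` of (1.38) with its polydisc data (separately
holomorphic in `σ` on `U ⊇ {|σ| ≤ e^{κ₁}}`, analytic in `B′` on `‖B′‖ < a₁e^{−16κ₁}`, sup bound `C₃′(e^{16κ₁}‖B′‖)³M⁴` —
[15], by reference), the (1.38)-parameters being the other cubes of Y at base point `s = 0`; the field map (1.19)
`Ψ₁ Y φ : B ↦ B′` analytic on `‖w‖ < R₀` with (1.20) `‖Ψ₁ Y φ w‖ ≤ C₁‖w‖`, `3ε₁ ≤ R₀`, `C₁R₀ ≤ a₁e^{−16κ₁}` (at `R₀ = 3ε₁`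
the printed proviso *"if e^{16κ₁}|B′| ≦ ⅓a₁"* at `|B′| < C₁ε₁`, `B13PkScaling.proviso_iff`); the identification of the
record's matrix elements with the □-sum of the per-term operators (`hQ`), the space (1.34) in coordinates (`hsp`),
`volk = #Y`, `κ₁ ≥ 11/3` (⊂ R12) and the floor `27·C₃′·C₁³·e^{49κ₁−1} ≤ C₃e^{C₂κ₁}`.  CONCLUSION: `B13.Bound143 W.toStepData c`
— by `B13Lemma2Torus.bound143_twoTorus` with one term per cube (`m = 1`), its per-term data from
`cubicData_T7_of_polydisc`. [cite: Balaban1988RG2Cluster, (1.37)–(1.43) pp.10–11] -/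
theorem bound143_twoTorus_T7 (W : TwoTorusStep 4 L N') (c : B13.Consts)
    {E F : Type*} [NormedAddCommGroup E] [NormedSpace ℂ E] [NormedAddCommGroup F] [NormedSpace ℂ F]
    (rd : TDom 4 (L * N') → W.Φ → E) (e : TDom 4 (L * N') → W.Bond → E) (he : ∀ Y b, ‖e Y b‖ ≤ 1)
    {a₁ C₃' R₀ r : ℝ} (ha₁ : 0 < a₁) (hC₃' : 0 ≤ C₃') (hC₁ : 0 ≤ c.C₁) (hκ₁ : 11 / 3 ≤ c.κ₁)
    {U : Set ℂ} (hU : IsOpen U) (hUexp : closedBall (0 : ℂ) (Real.exp c.κ₁) ⊆ U)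
    (hr : 0 < r) (hr' : r ≤ Real.exp c.κ₁ - 1)
    -- the underintegral expression of (1.38) per (Y, □) at the configuration φ, with its polydisc data ([15])
    (Ψ : TDom 4 (L * N') → TPt 4 (L * N') → W.Φ → F → (TPt 4 (L * N') → ℂ) → ℂ)
    (hΨan : ∀ Y, ∀ q ∈ Y.1, ∀ φ ∈ W.sp1 Y, ∀ σ : TPt 4 (L * N') → ℂ, (∀ j, σ j ∈ U) →
      AnalyticOnNhd ℂ (fun B' => Ψ Y q φ B' σ) (ball 0 (rad c.κ₁ a₁)))
    (hΨhol : ∀ Y, ∀ q ∈ Y.1, ∀ φ ∈ W.sp1 Y, ∀ B' ∈ ball (0 : F) (rad c.κ₁ a₁), SepHolOn U (Ψ Y q φ B'))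
    (hΨbd : ∀ Y, ∀ q ∈ Y.1, ∀ φ ∈ W.sp1 Y, ∀ B' ∈ ball (0 : F) (rad c.κ₁ a₁), ∀ σ : TPt 4 (L * N') → ℂ,
      (∀ j, ‖σ j‖ ≤ Real.exp c.κ₁) → ‖Ψ Y q φ B' σ‖ ≤ C₃' * (Real.exp (16 * c.κ₁) * ‖B'‖) ^ 3 * c.M ^ 4)
    -- the field map (1.19) `B ↦ B′` (depending on the configuration through V^{(k)}) with (1.20)
    (Ψ₁ : TDom 4 (L * N') → W.Φ → E → F) (hΨ₁ : ∀ Y, ∀ φ ∈ W.sp1 Y, AnalyticOnNhd ℂ (Ψ₁ Y φ) (ball 0 R₀))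
    (h120 : ∀ Y, ∀ φ ∈ W.sp1 Y, ∀ w ∈ ball (0 : E) R₀, ‖Ψ₁ Y φ w‖ ≤ c.C₁ * ‖w‖) (h3 : 3 * c.ε₁ ≤ R₀)
    (hrad : c.C₁ * R₀ ≤ rad c.κ₁ a₁) (hε₁ : 0 < c.ε₁) {g : ℂ} (hg : g ≠ 0)
    -- the record's matrix elements, the space (1.34), the cube count, the constants
    (hQ : ∀ Y φ (b b' : W.Bond), φ ∈ W.sp1 Y →
      W.Q Y φ b b' = 2 * ∑ q ∈ Y.1,
        Qop (scaled g ((fun B' => TopC r (Y.1.erase q).toList (Ψ Y q φ B') 0) ∘ Ψ₁ Y φ)) (rd Y φ) (e Y b)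
          (e Y b'))
    (hsp : ∀ Y φ, φ ∈ W.sp1 Y → ‖g‖ * ‖rd Y φ‖ < c.ε₁)
    (hvolk : ∀ Y, W.volk Y = Y.1.card)
    (hfloor : 27 * C₃' * c.C₁ ^ 3 * Real.exp (49 * c.κ₁ - 1) ≤ c.C₃ * Real.exp (c.C₂ * c.κ₁)) :
    B13.Bound143 W.toStepData c := by
  have hκ₁1 : 1 ≤ c.κ₁ := by linarith
  have hR₀ : 0 < R₀ := by linarith
  have hp0 : ∀ j : TPt 4 (L * N'), ‖(0 : TPt 4 (L * N') → ℂ) j‖ ≤ 1 := fun j => by simp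
  -- the per-term data of every (Y, □, φ) from the polydisc data
  have hdata : ∀ Y : TDom 4 (L * N'), ∀ q ∈ Y.1, ∀ φ ∈ W.sp1 Y,
      AnalyticOnNhd ℂ ((fun B' => TopC r (Y.1.erase q).toList (Ψ Y q φ B') 0) ∘ Ψ₁ Y φ) (ball 0 R₀) ∧
        ∀ w ∈ ball (0 : E) R₀, ‖((fun B' => TopC r (Y.1.erase q).toList (Ψ Y q φ B') 0) ∘ Ψ₁ Y φ) w‖ ≤
          C₃' * Real.exp (48 * c.κ₁) * (c.M ^ 4 * Real.exp (-(c.κ₁ - 1) * (Y.1.erase q).toList.length)) *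
            c.C₁ ^ 3 * ‖w‖ ^ 3 :=
    fun Y q hq φ hφ => cubicData_T7_of_polydisc ha₁ hC₃' hC₁ hκ₁1 hU hUexp hr hr' (hΨan Y q hq φ hφ)
      (hΨhol Y q hq φ hφ) (hΨbd Y q hq φ hφ) (Finset.nodup_toList _) hp0 (hΨ₁ Y φ hφ) (h120 Y φ hφ) hrad
  refine bound143_twoTorus W c rd e he (fun Y => Y.1)
    (fun Y q φ => (fun B' => TopC r (Y.1.erase q).toList (Ψ Y q φ B') 0) ∘ Ψ₁ Y φ) hg
    (K := C₃' * Real.exp (48 * c.κ₁) * c.M ^ 4 * c.C₁ ^ 3) (m := 1) (by positivity) hR₀ h3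
    (fun Y q hq φ hφ => (hdata Y q hq φ hφ).1) ?_ (fun Y => le_of_eq (one_mul _).symm) hQ hsp hvolk hκ₁ ?_
  · -- the cubic bound with the (1.39)-rate `e^{−(κ₁−1)(#Y−1)}`
    intro Y q hq φ hφ z hz
    have h := (hdata Y q hq φ hφ).2 z hz
    rw [length_params_eq hq] at h
    calc ‖((fun B' => TopC r (Y.1.erase q).toList (Ψ Y q φ B') 0) ∘ Ψ₁ Y φ) z‖
        ≤ C₃' * Real.exp (48 * c.κ₁) * (c.M ^ 4 * Real.exp (-(c.κ₁ - 1) * ((Y.1.card : ℝ) - 1))) *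
            c.C₁ ^ 3 * ‖z‖ ^ 3 := h
      _ = C₃' * Real.exp (48 * c.κ₁) * c.M ^ 4 * c.C₁ ^ 3 *
            Real.exp (-(c.κ₁ - 1) * ((Y.1.card : ℝ) - 1)) * ‖z‖ ^ 3 := by ring
  · -- the floor: `27·C₃′C₁³e^{49κ₁−1} ≤ C₃e^{C₂κ₁}` times `M⁴ ≥ 0`
    have hM4 : 0 ≤ c.M ^ 4 := by positivity
    have he49 : Real.exp (48 * c.κ₁) * Real.exp (c.κ₁ - 1) = Real.exp (49 * c.κ₁ - 1) := by
      rw [← Real.exp_add]; congr 1; ring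
    calc 27 * ((1 : ℕ) : ℝ) * (C₃' * Real.exp (48 * c.κ₁) * c.M ^ 4 * c.C₁ ^ 3) * Real.exp (c.κ₁ - 1)
        = 27 * C₃' * c.C₁ ^ 3 * (Real.exp (48 * c.κ₁) * Real.exp (c.κ₁ - 1)) * c.M ^ 4 := by
          rw [Nat.cast_one]; ring
      _ = 27 * C₃' * c.C₁ ^ 3 * Real.exp (49 * c.κ₁ - 1) * c.M ^ 4 := by rw [he49]
      _ ≤ c.C₃ * Real.exp (c.C₂ * c.κ₁) * c.M ^ 4 := mul_le_mul_of_nonneg_right hfloor hM4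
      _ = c.C₃ * c.M ^ 4 * Real.exp (c.C₂ * c.κ₁) := by ring

end Torus

end Literature.MathematicalPhysics.QuantumFieldTheory.Balaban1983to89.B13Lemma2TorusT7

end
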